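/-
Copyright: the b2b-balaban T⁴-continuum CRUX team, row NE7b OWNER lineage `t4-ne7b-p1` (gen 145). Project licence.
-/
import Summits.QuantumFields.BalabanUV.T4Continuum.Spine.NE7b.SupFourthFormContDiff
import Summits.QuantumFields.BalabanUV.T4Continuum.Spine.NE7b.SupThirdFormDifferentiable

/-!
# THE OUTPUT'S FIFTH-ORDER OBJECT `P(ψ)` IS CONTINUOUS IN THE BACKGROUND — THE INPUT'S `hU₅c` REPRODUCED (CONTINUITY OF THE TOP
# DERIVATIVE, SCOPING-d16 (4), THE END; the last analytic clause of the kernel-letter class at `d = 4`).  The INPUT format of a fluctuation step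
# carries `hU₄d : HasFDerivAt U₄ (U₅ φ) φ` AND `hU₅c : Continuous U₅`.  For the OUTPUT `W`: (533) packaged `∂³W` as `T(ψ)` with
# `HasFDerivAt T Q(ψ) ψ`; (639) proved `HasFDerivAt Q P(ψ) ψ` with the composed `5`-linear map
#   `P(ψ) = Σ_{x,y,z} (L ↦ L·b_{xyz}) ∘ (Σ_n (fderiv (ψ″ ↦ fderiv(T(·)[e_x,e_y,e_z])ψ″[e_n]) ψ)·proj_n)`   (the output's `hU₄d`);
# (641)∕(642)∕(643) gave its entry majorant, row letter and operator letter.  Here, THE END: `ψ ↦ P(ψ)` is CONTINUOUS, for `U ∈ C⁵` with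
# bounded `U″…U⁽⁵⁾`, `U⁽⁵⁾` continuous, `Γ ⪰ 0` under the regulator — by (532) `fderiv_third_form_apply` (the inner scalar function IS (521)'s
# centred display `ψ″ ↦ ∂⁴W(ψ″)[e_n;e_x,e_y,e_z]` at every `ψ″`, so their `fderiv`s agree: `Filter.EventuallyEq.fderiv_eq`), (646)
# `continuous_fderiv_fourth_form` (that display is `C¹`, its `fderiv` continuous — dominated convergence on the tilted moments, NO fifth display
# written), and continuity of the constant continuous (bi)linear assembly (`smulRight`, composition, finite sums) (row NE7b, node U5c; (646),
# (532) BY NAME + Mathlib; [folklore]).  With (639) (`hU₄d`), (641) (`hK5`), (642) (row), (643) (`hU₅b`) and the slot letters (612)…(634), the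
# order-5 data of the OUTPUT are in the INPUT's format: the kernel-letter class {orders 1–5} CLOSES under the step (the class-map
# iteration (d14)(3) is pure letter algebra from here).

Cell `pub-balaban`, sub-cell `t4`, spine estimate NE7b (`T4WeightBudget.RelWeightBound`; the cell's OWN estimate — NOT PRINTED in
[Bałaban 1983–89], NOT PROVED).  Crux-route work under `Spine/NE7b/` by the row OWNER (`t4-ne7b-p1` gen 145, file (647)) under FREEZE
(0)'s crux-prover clause; NOTHING of Bałaban's is named as a Lean object, valued or asserted; no `T4Continuum/Support` leaf typed; no
`def`, no notation (`P(ψ)` WRITTEN OUT); zero `sorry`.  Imports (BY NAME): the OWNER's (646) `…SupFourthFormContDiff`, (532)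
`…SupThirdFormDifferentiable`.

WHAT IS PROVED ([folklore]): THE END **`continuous_fifth_form_clm`**; toy.

HONEST (what this is NOT).  Regularity bookkeeping: continuity only (no modulus of continuity, no `ContDiff ℝ 5` object for `W`); the
letters are (641)–(643); the class-map ITERATION∕location∕rescaling ((d14)(3), (432)–(436)) is NOT here; `U ∈ C⁵` with bounded derivatives
and the regulator are hypotheses; scalar skeleton ((A3), NC-NE7b-α UNRULED); nothing of Bałaban's asserted.  BY-NAME EFFECT ON THE WALL:
NONE.  NE7b NOT PRINTED ∕ NOT PROVED; spine PROVED 0∕9; rung (B)+1 — the programme's measures remain FINITE-torus statements; NOT the mass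
gap, NOT Clay.  HONEST DEPENDENCY: continuum YM on T⁴ ⇐ BetaPertH ∧ nine spine estimates (0∕9 proved); BetaPertH ⇐ (D1) ∧ (D4) ∧ CAP+tail;
G-an2-4 gates asym, D1 and NE2∕3∕4.
-/

set_option autoImplicit false
set_option maxSynthPendingDepth 4

noncomputable section

namespace Summit.QuantumFields.BalabanUV.T4Continuum.NE7b.SupFifthFormContinuous

open MeasureTheory ProbabilityTheory Finset Real Matrix
open scoped Topology
open SupFourthFormContDiff (continuous_fderiv_fourth_form)
open SupThirdFormDifferentiable (fderiv_third_form_apply)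

variable {ι : Type} [Fintype ι] [DecidableEq ι]

section Main

variable {Γ : Matrix ι ι ℝ} {γop : ℝ} {U : EuclideanSpace ℝ ι → ℝ} {U' : EuclideanSpace ℝ ι → EuclideanSpace ℝ ι →L[ℝ] ℝ}
  {U'' : EuclideanSpace ℝ ι → EuclideanSpace ℝ ι →L[ℝ] EuclideanSpace ℝ ι →L[ℝ] ℝ}
  {U₃ : EuclideanSpace ℝ ι → EuclideanSpace ℝ ι →L[ℝ] EuclideanSpace ℝ ι →L[ℝ] EuclideanSpace ℝ ι →L[ℝ] ℝ}
  {U₄ : EuclideanSpace ℝ ι → EuclideanSpace ℝ ι →L[ℝ] EuclideanSpace ℝ ι →L[ℝ] EuclideanSpace ℝ ι →L[ℝ]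
    EuclideanSpace ℝ ι →L[ℝ] ℝ}
  {U₅ : EuclideanSpace ℝ ι → EuclideanSpace ℝ ι →L[ℝ] EuclideanSpace ℝ ι →L[ℝ] EuclideanSpace ℝ ι →L[ℝ]
    EuclideanSpace ℝ ι →L[ℝ] EuclideanSpace ℝ ι →L[ℝ] ℝ}
  {κ₀ κ₁ a τ δ θ κ₂ κ₃ κ₄ κ₅ : ℝ}

set_option maxHeartbeats 4000000 in
/-- **THE END: `ψ ↦ P(ψ)` — the output's fifth-order object, (639)'s Fréchet derivative of `Q` — IS CONTINUOUS** (the input's `hU₅c`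
reproduced), for `U ∈ C⁵` with bounded `U″…U⁽⁵⁾`, `U⁽⁵⁾` continuous, under the regulator. [folklore] -/
theorem continuous_fifth_form_clm
    (hΓ : Γ.PosSemidef) (hΓop : (γop • (1 : Matrix ι ι ℝ) - Γ).PosSemidef) (Y : Finset ι) (hUd : ∀ φ : EuclideanSpace ℝ ι, HasFDerivAt U (U' φ) φ)
    (hU'd : ∀ φ : EuclideanSpace ℝ ι, HasFDerivAt U' (U'' φ) φ) (hU''d : ∀ φ : EuclideanSpace ℝ ι, HasFDerivAt U'' (U₃ φ) φ) (hU₃d : ∀ φ :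
    EuclideanSpace ℝ ι, HasFDerivAt U₃ (U₄ φ) φ) (hU₄d : ∀ φ : EuclideanSpace ℝ ι, HasFDerivAt U₄ (U₅ φ) φ) (hU₅c : Continuous U₅) (hκ₀ : 0 ≤ κ₀)
    (hκ₁ : 0 ≤ κ₁) (ha : 0 ≤ a) (hτ : 0 < τ) (hδ : 0 < δ) (hθ1 : θ < 1) (hκθ : (2 * κ₀ * (1 + τ) + 4 * δ) * γop ≤ θ) (hstab : ∀ φ : EuclideanSpace ℝ
    ι, -(κ₀ * ∑ x ∈ Y, φ x ^ 2) ≤ U φ) (hU'b : ∀ φ : EuclideanSpace ℝ ι, ‖U' φ‖ ≤ κ₁ * (a + ∑ x ∈ Y, φ x ^ 2)) (hθ0 : 0 < θ) (hU''b : ∀ φ :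
    EuclideanSpace ℝ ι, ‖U'' φ‖ ≤ κ₂) (hU₃b : ∀ φ : EuclideanSpace ℝ ι, ‖U₃ φ‖ ≤ κ₃) (hU₄b : ∀ φ : EuclideanSpace ℝ ι, ‖U₄ φ‖ ≤ κ₄) (hU₅b : ∀ φ :
    EuclideanSpace ℝ ι, ‖U₅ φ‖ ≤ κ₅) :
    Continuous (fun ψ : EuclideanSpace ℝ ι => ∑ x, ∑ y, ∑ z, ((ContinuousLinearMap.smulRightL ℝ (EuclideanSpace ℝ ι) (EuclideanSpace ℝ ι →L[ℝ]
        EuclideanSpace ℝ ι →L[ℝ] EuclideanSpace ℝ ι →L[ℝ] ℝ)).flip ((EuclideanSpace.proj x : EuclideanSpace ℝ ι →L[ℝ] ℝ).smulRight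
        ((EuclideanSpace.proj y : EuclideanSpace ℝ ι →L[ℝ] ℝ).smulRight (EuclideanSpace.proj z : EuclideanSpace ℝ ι →L[ℝ] ℝ)))).comp (∑ n : ι,
        (fderiv ℝ (fun ψ : EuclideanSpace ℝ ι => (fderiv ℝ (fun ψ' : EuclideanSpace ℝ ι => ((∫ ω : EuclideanSpace ℝ ι, exp (-U (ω + ψ'))
        ∂(multivariateGaussian 0 Γ)))⁻¹ * (∫ ω : EuclideanSpace ℝ ι, exp (-U (ω + ψ')) * (U₃ (ω + ψ') (EuclideanSpace.single x (1 : ℝ))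
        (EuclideanSpace.single y (1 : ℝ)) (EuclideanSpace.single z (1 : ℝ)) - U' (ω + ψ') (EuclideanSpace.single y (1 : ℝ)) * U'' (ω + ψ')
        (EuclideanSpace.single x (1 : ℝ)) (EuclideanSpace.single z (1 : ℝ)) - U'' (ω + ψ') (EuclideanSpace.single x (1 : ℝ)) (EuclideanSpace.single
        y (1 : ℝ)) * U' (ω + ψ') (EuclideanSpace.single z (1 : ℝ)) - U' (ω + ψ') (EuclideanSpace.single x (1 : ℝ)) * U'' (ω + ψ')
        (EuclideanSpace.single y (1 : ℝ)) (EuclideanSpace.single z (1 : ℝ)) + U' (ω + ψ') (EuclideanSpace.single x (1 : ℝ)) * U' (ω + ψ')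
        (EuclideanSpace.single y (1 : ℝ)) * U' (ω + ψ') (EuclideanSpace.single z (1 : ℝ))) ∂(multivariateGaussian 0 Γ)) + ((∫ ω : EuclideanSpace ℝ
        ι, exp (-U (ω + ψ')) ∂(multivariateGaussian 0 Γ)) ^ 2)⁻¹ * (∫ ω : EuclideanSpace ℝ ι, exp (-U (ω + ψ')) * U' (ω + ψ') (EuclideanSpace.single
        x (1 : ℝ)) ∂(multivariateGaussian 0 Γ)) * (∫ ω : EuclideanSpace ℝ ι, exp (-U (ω + ψ')) * (U'' (ω + ψ') (EuclideanSpace.single y (1 : ℝ))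
        (EuclideanSpace.single z (1 : ℝ)) - U' (ω + ψ') (EuclideanSpace.single y (1 : ℝ)) * U' (ω + ψ') (EuclideanSpace.single z (1 : ℝ)))
        ∂(multivariateGaussian 0 Γ)) + ((∫ ω : EuclideanSpace ℝ ι, exp (-U (ω + ψ')) ∂(multivariateGaussian 0 Γ)) ^ 2)⁻¹ * (∫ ω : EuclideanSpace ℝ
        ι, exp (-U (ω + ψ')) * U' (ω + ψ') (EuclideanSpace.single y (1 : ℝ)) ∂(multivariateGaussian 0 Γ)) * (∫ ω : EuclideanSpace ℝ ι, exp (-U (ω +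
        ψ')) * (U'' (ω + ψ') (EuclideanSpace.single x (1 : ℝ)) (EuclideanSpace.single z (1 : ℝ)) - U' (ω + ψ') (EuclideanSpace.single x (1 : ℝ)) *
        U' (ω + ψ') (EuclideanSpace.single z (1 : ℝ))) ∂(multivariateGaussian 0 Γ)) + (((∫ ω : EuclideanSpace ℝ ι, exp (-U (ω + ψ'))
        ∂(multivariateGaussian 0 Γ)) ^ 2)⁻¹ * (∫ ω : EuclideanSpace ℝ ι, exp (-U (ω + ψ')) * (U'' (ω + ψ') (EuclideanSpace.single x (1 : ℝ))
        (EuclideanSpace.single y (1 : ℝ)) - U' (ω + ψ') (EuclideanSpace.single x (1 : ℝ)) * U' (ω + ψ') (EuclideanSpace.single y (1 : ℝ)))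
        ∂(multivariateGaussian 0 Γ)) + -2 / (∫ ω : EuclideanSpace ℝ ι, exp (-U (ω + ψ')) ∂(multivariateGaussian 0 Γ)) ^ 3 * -(∫ ω : EuclideanSpace ℝ
        ι, exp (-U (ω + ψ')) * U' (ω + ψ') (EuclideanSpace.single x (1 : ℝ)) ∂(multivariateGaussian 0 Γ)) * (∫ ω : EuclideanSpace ℝ ι, exp (-U (ω +
        ψ')) * U' (ω + ψ') (EuclideanSpace.single y (1 : ℝ)) ∂(multivariateGaussian 0 Γ))) * (∫ ω : EuclideanSpace ℝ ι, exp (-U (ω + ψ')) * U' (ω +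
        ψ') (EuclideanSpace.single z (1 : ℝ)) ∂(multivariateGaussian 0 Γ))) ψ) (EuclideanSpace.single n (1 : ℝ))) ψ).smulRight (EuclideanSpace.proj
        n : EuclideanSpace ℝ ι →L[ℝ] ℝ))) := by
  have hU₄c : Continuous U₄ := continuous_iff_continuousAt.2 fun φ => (hU₄d φ).continuousAt
  have he : ∀ v : ι, ‖(EuclideanSpace.single v (1 : ℝ) : EuclideanSpace ℝ ι)‖ ≤ 1 := fun v => by simp
  refine continuous_finsetSum _ fun x _ => continuous_finsetSum _ fun y _ => continuous_finsetSum _ fun z _ => ?_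
  refine continuous_const.clm_comp (continuous_finsetSum _ fun n _ => ?_)
  have hc := (continuous_fderiv_fourth_form hΓ hΓop Y hUd hU'd hU''d hU₃d hU₄d hU₅c hκ₀ hκ₁ ha hτ hδ hθ1 hκθ hstab hU'b hθ0 hU''b hU₃b hU₄b hU₅b
        (he x) (he y) (he z) (he n)).congr fun ψ =>
    Filter.EventuallyEq.fderiv_eq (Filter.Eventually.of_forall fun ψ'' : EuclideanSpace ℝ ι =>
      (fderiv_third_form_apply hΓ hΓop Y hUd hU'd hU''d hU₃d hU₄c hκ₀ hκ₁ ha hτ hδ hθ1 hκθ hstab hU'b hθ0 hU''b hU₃b hU₄b ψ'' (he x) (he y) (he z)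
        (EuclideanSpace.single n (1 : ℝ))).symm)
  exact isBoundedBilinearMap_smulRight.continuous.comp (hc.prodMk continuous_const)

end Main

/-! ## Toy -/

/-- Toy (the assembly step in one variable): a continuous covector-valued map tensored with a fixed covector is continuous. -/
example (c : ℝ → ℝ →L[ℝ] ℝ) (hc : Continuous c) (f : ℝ →L[ℝ] ℝ) : Continuous fun x => (c x).smulRight f :=
  isBoundedBilinearMap_smulRight.continuous.comp (hc.prodMk continuous_const)

end Summit.QuantumFields.BalabanUV.T4Continuum.NE7b.SupFifthFormContinuous

end
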